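import Literature.Barriers.ABC.BakerMethodBoundsYuInputProofs
import HarnessLib

/-!
# The archimedean approximation bound over `ℚ` from a core in SHAPE form — elimination of
# multiplicative relations (dependent positive rationals from independent ones)

Topic `NumberTheory/DiophantineGeometry`; namespace `Literature.NumberTheory.DiophantineGeometry.Dioph`.
Proofs only: no definition, no named fact. Archimedean twin of
`ApproximationBoundRatPadicDependenceProofs.lean`.

`depArch_of_indepArch`: a lower bound in shape form for linear forms in logarithms of
multiplicatively INDEPENDENT positive rationals (the text of Nesterenko 2003, Thm 2.2 = Matveev 2000
over `ℚ`, with the constant `cⁿ`: weights `h(aₖ) ≤ Aₖ`, `1 ≤ Aₖ`, exponents `b ≠ 0`, `|bₖ| ≤ B`,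
conclusion `log|∑ bₖ log aₖ| ≥ −C₀ⁿ·∏ Aₖ·log(eB)`) implies a bound of the same kind for DEPENDENT
positive rationals `aₖ ≠ 1` in the additive log slot `log B + ∑ log(3h(aₖ)) + 2n` with plain heights
as weights and constant `C = (C₀ + 3)/log 2`, the linear form being written `log ∏ aₖ^{bₖ}`. Proof:
strong induction on the number of `aₖ` (Nesterenko 2003, Prop 2.6 / Loxton–van der Poorten
pattern; explicit twin in the tree: `Dioph.matveev2000_linearFormsLog_rat_of_thm21`): a dependent
datum carries a small relation `∏ aₖ^{2tₖ} = 1` (`exists_small_mult_relation`), one index `j` is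
eliminated by `Λ ↦ 2tⱼ Λ` (`prod_zpow_zpow_eq_prod_erase`), at the cost `log|2tⱼ| ≤ log m*`
(`yu2007_mstar_log_aux`), absorbed by the slot.

## References

* [Nesterenko2003] Yu. V. Nesterenko, *Linear forms in logarithms of rational numbers*, in:
  Diophantine approximation (Cetraro, 2000), LNM 1819 (2003) — Thm 2.1/2.2, Prop 2.6.
* [EvertseGyory2015] J.-H. Evertse, K. Győry, *Unit Equations in Diophantine Number Theory*,
  CUP 2015 — §4.4.2 (pp. 80–81).
-/

noncomputable section

open Finset Real Height

namespace Literature.NumberTheory.DiophantineGeometry.Dioph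

/-! ### Elementary lemmas -/

/-- `1 ≤ ∏_{k ∈ s} A k` when every `A k ≥ 1`. [folklore] -/
private theorem one_le_prod_of_one_le' {κ : Type} (s : Finset κ) {A : κ → ℝ} (hA : ∀ k, 1 ≤ A k) :
    1 ≤ ∏ k ∈ s, A k :=
  Finset.prod_induction A (fun x => 1 ≤ x) (fun _ _ ha hb => one_le_mul_of_one_le_of_one_le ha hb)
    le_rfl fun k _ => hA k

/-- The linear form in logarithms as the logarithm of the product: for positive rationals `aₖ`,
`log ∏ aₖ^{bₖ} = ∑ bₖ log aₖ` (in `ℝ`). [folklore] -/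
private theorem log_cast_prod_zpow {κ : Type} [Fintype κ] (a : κ → ℚ) (ha : ∀ k, 0 < a k)
    (b : κ → ℤ) :
    Real.log ((∏ k, a k ^ b k : ℚ) : ℝ) = ∑ k, (b k : ℝ) * Real.log (a k : ℝ) := by
  push_cast
  rw [Real.log_prod (s := univ) (fun k _ => zpow_ne_zero _ (by exact_mod_cast (ha k).ne'))]
  refine Finset.sum_congr rfl fun k _ => ?_
  rw [Real.log_zpow]

/-- For positive rationals with `∏ aₖ^{bₖ} ≠ 1` the linear form `log ∏ aₖ^{bₖ}` is non-zero.
[folklore] -/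
private theorem log_cast_prod_zpow_ne_zero {κ : Type} [Fintype κ] (a : κ → ℚ) (ha : ∀ k, 0 < a k)
    (b : κ → ℤ) (hne : ∏ k, a k ^ b k ≠ 1) :
    Real.log ((∏ k, a k ^ b k : ℚ) : ℝ) ≠ 0 := by
  have hpos : (0 : ℚ) < ∏ k, a k ^ b k := Finset.prod_pos fun k _ => zpow_pos (ha k) _
  apply Real.log_ne_zero_of_pos_of_ne_one (by exact_mod_cast hpos)
  exact_mod_cast hne

/-! ### The independent case: change of currency -/

/-- **Base of the induction** (independent positive `aₖ`): the shape bound for independent positive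
rationals with weights `Aₖ := h(aₖ)/log 2` and `log(eB) = 1 + log B` is at most the additive-slot
bound with constant `C ≥ C₀/log 2`. [cite: Nesterenko2003, Thm 2.2] -/
theorem depArch_of_indepArch_base {C₀ C : ℝ} (hC₀ : 1 ≤ C₀) (hC : C₀ / Real.log 2 ≤ C)
    (hind : ∀ (κ : Type) [Fintype κ] [DecidableEq κ] (a : κ → ℚ) (b : κ → ℤ) (A : κ → ℝ) (B : ℝ),
      (∀ k, 0 < a k) → (∀ μ : κ → ℤ, ∏ k, a k ^ μ k = 1 → μ = 0) →
      (∀ k, logHeight₁ (a k) ≤ A k) → (∀ k, 1 ≤ A k) → b ≠ 0 → (∀ k, (|b k| : ℝ) ≤ B) →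
      -(C₀ ^ Fintype.card κ * (∏ k, A k) * Real.log (Real.exp 1 * B)) ≤
        Real.log |∑ k, (b k : ℝ) * Real.log (a k : ℝ)|)
    {κ : Type} [Fintype κ] [DecidableEq κ] (a : κ → ℚ) (b : κ → ℤ) (B : ℝ)
    (ha : ∀ k, 0 < a k) (ha1 : ∀ k, a k ≠ 1) (hB : ∀ k, (|b k| : ℝ) ≤ B) (hB3 : 3 ≤ B)
    (hne : ∏ k, a k ^ b k ≠ 1) (hindep : ∀ μ : κ → ℤ, ∏ k, a k ^ μ k = 1 → μ = 0) :
    -(C ^ Fintype.card κ * (∏ k, logHeight₁ (a k)) *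
        (Real.log B + ∑ k, Real.log (3 * logHeight₁ (a k)) + 2 * Fintype.card κ)) ≤
      Real.log |Real.log ((∏ k, a k ^ b k : ℚ) : ℝ)| := by
  set n := Fintype.card κ with hn
  set h : κ → ℝ := fun k => logHeight₁ (a k) with hh
  have hl2 : 0 < Real.log 2 := Real.log_pos one_lt_two
  have hl2' : Real.log 2 ≤ 1 := by linarith [Real.log_two_lt_d9]
  have ha0 : ∀ k, a k ≠ 0 := fun k => (ha k).ne'
  have ha2 : ∀ k, a k ≠ -1 := fun k h0 => by have := ha k; rw [h0] at this; norm_num at this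
  have hh2 : ∀ k, Real.log 2 ≤ h k := fun k => log_two_le_logHeight₁ (ha0 k) (ha1 k) (ha2 k)
  have hhpos : ∀ k, 0 < h k := fun k => lt_of_lt_of_le hl2 (hh2 k)
  have hb0 : b ≠ 0 := by intro h0; apply hne; simp [h0]
  have hn1 : 1 ≤ n := by
    rw [hn]; by_contra h0; push Not at h0
    have : Fintype.card κ = 0 := by omega
    haveI : IsEmpty κ := Fintype.card_eq_zero_iff.mp this
    exact hb0 (funext fun k => isEmptyElim k)
  set A : κ → ℝ := fun k => h k / Real.log 2 with hA
  have hA1 : ∀ k, 1 ≤ A k := fun k => by rw [hA]; dsimp only; rw [le_div_iff₀ hl2]; linarith [hh2 k]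
  have hAh : ∀ k, logHeight₁ (a k) ≤ A k := fun k => by
    rw [hA]; dsimp only; rw [le_div_iff₀ hl2]; nlinarith [hhpos k]
  have hB0 : 0 < B := by linarith
  have hmain := hind κ a b A B ha hindep hAh hA1 hb0 hB
  rw [← log_cast_prod_zpow a ha b] at hmain
  have hprodA : ∏ l, A l = (∏ l, h l) / Real.log 2 ^ n := by
    rw [hA]; dsimp only
    rw [Finset.prod_div_distrib, Finset.prod_const, Finset.card_univ]
  have hlog3h : ∀ k, 0 ≤ Real.log (3 * h k) := fun k =>
    Real.log_nonneg (by linarith [hh2 k, Real.log_two_gt_d9])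
  have hU0 : 0 ≤ ∑ k, Real.log (3 * h k) := Finset.sum_nonneg fun k _ => hlog3h k
  have hlogeB : Real.log (Real.exp 1 * B) = 1 + Real.log B := by
    rw [Real.log_mul (Real.exp_pos 1).ne' hB0.ne', Real.log_exp]
  have hslot : Real.log (Real.exp 1 * B) ≤ Real.log B + ∑ k, Real.log (3 * h k) + 2 * n := by
    rw [hlogeB]
    have : (1 : ℝ) ≤ n := by exact_mod_cast hn1
    linarith
  have hslot0 : 0 ≤ Real.log (Real.exp 1 * B) := by
    rw [hlogeB]; linarith [Real.log_nonneg (show (1 : ℝ) ≤ B by linarith)]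
  have hconst : C₀ ^ n * ∏ l, A l ≤ C ^ n * ∏ l, h l := by
    rw [hprodA, show C₀ ^ n * ((∏ l, h l) / Real.log 2 ^ n) = (C₀ / Real.log 2) ^ n * ∏ l, h l by
      rw [div_pow]; field_simp]
    exact mul_le_mul_of_nonneg_right
      (pow_le_pow_left₀ (div_nonneg (by linarith) hl2.le) hC n)
      (Finset.prod_nonneg fun l _ => (hhpos l).le)
  have hA0 : 0 ≤ C₀ ^ n * ∏ l, A l :=
    mul_nonneg (pow_nonneg (by linarith) n) (Finset.prod_nonneg fun l _ => by linarith [hA1 l])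
  have hcmp : C₀ ^ n * (∏ l, A l) * Real.log (Real.exp 1 * B) ≤
      C ^ n * (∏ l, h l) * (Real.log B + ∑ k, Real.log (3 * h k) + 2 * n) :=
    mul_le_mul hconst hslot hslot0 (le_trans hA0 hconst)
  linarith


/-! ### The induction: eliminating multiplicative relations -/

set_option maxHeartbeats 400000 in
/-- **Dependent from independent** (archimedean): the shape bound for linear forms in logarithms of
multiplicatively independent positive rationals (`hind`, constant `C₀ ≥ 1`, slot `log(eB)`) implies
the shape bound for arbitrary positive rationals `aₖ ≠ 1` with plain heights as weights, additive
slot `log B + ∑ₖ log(3h(aₖ)) + 2n` and constant `(C₀ + 3)/log 2`, the linear form written as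
`log ∏ aₖ^{bₖ}`: strong induction on the number of `aₖ`; a dependent datum carries a small relation
(`exists_small_mult_relation`), one of whose indices is eliminated by `Λ ↦ 2tⱼ·Λ`
(`prod_zpow_zpow_eq_prod_erase`) at the cost `log|2tⱼ| ≤ log m* ≤ 0.7 + 1.2n + ∑ log h(aₖ)`.
[cite: Nesterenko2003, Prop 2.6] -/
theorem depArch_of_indepArch {C₀ : ℝ} (hC₀ : 1 ≤ C₀)
    (hind : ∀ (κ : Type) [Fintype κ] [DecidableEq κ] (a : κ → ℚ) (b : κ → ℤ) (A : κ → ℝ) (B : ℝ),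
      (∀ k, 0 < a k) → (∀ μ : κ → ℤ, ∏ k, a k ^ μ k = 1 → μ = 0) →
      (∀ k, logHeight₁ (a k) ≤ A k) → (∀ k, 1 ≤ A k) → b ≠ 0 → (∀ k, (|b k| : ℝ) ≤ B) →
      -(C₀ ^ Fintype.card κ * (∏ k, A k) * Real.log (Real.exp 1 * B)) ≤
        Real.log |∑ k, (b k : ℝ) * Real.log (a k : ℝ)|)
    (κ : Type) [Fintype κ] [DecidableEq κ] (a : κ → ℚ) (b : κ → ℤ) (B : ℝ)
    (ha : ∀ k, 0 < a k) (ha1 : ∀ k, a k ≠ 1) (hB : ∀ k, (|b k| : ℝ) ≤ B) (hB3 : 3 ≤ B)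
    (hne : ∏ k, a k ^ b k ≠ 1) :
    -(((C₀ + 3) / Real.log 2) ^ Fintype.card κ * (∏ k, logHeight₁ (a k)) *
        (Real.log B + ∑ k, Real.log (3 * logHeight₁ (a k)) + 2 * Fintype.card κ)) ≤
      Real.log |Real.log ((∏ k, a k ^ b k : ℚ) : ℝ)| := by
  set C : ℝ := (C₀ + 3) / Real.log 2 with hCdef
  have hl2 : 0 < Real.log 2 := Real.log_pos one_lt_two
  have hl2' : Real.log 2 ≤ 1 := by linarith [Real.log_two_lt_d9]
  have hCC₀ : C₀ / Real.log 2 ≤ C := by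
    rw [hCdef]; exact div_le_div_of_nonneg_right (by linarith) hl2.le
  have hC3 : 3 ≤ C * Real.log 2 := by
    rw [hCdef, div_mul_cancel₀ _ hl2.ne']; linarith
  have hC0 : 0 ≤ C := by rw [hCdef]; positivity
  suffices H : ∀ (n : ℕ) (κ : Type) [Fintype κ] [DecidableEq κ], Fintype.card κ = n →
      ∀ (a : κ → ℚ) (b : κ → ℤ) (B : ℝ),
      (∀ k, 0 < a k) → (∀ k, a k ≠ 1) → (∀ k, (|b k| : ℝ) ≤ B) → 3 ≤ B → ∏ k, a k ^ b k ≠ 1 →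
      -(C ^ Fintype.card κ * (∏ k, logHeight₁ (a k)) *
          (Real.log B + ∑ k, Real.log (3 * logHeight₁ (a k)) + 2 * Fintype.card κ)) ≤
        Real.log |Real.log ((∏ k, a k ^ b k : ℚ) : ℝ)| by
    exact H _ κ rfl a b B ha ha1 hB hB3 hne
  intro n
  induction n using Nat.strong_induction_on with
  | _ n IHn =>
  intro κ _ _ hcard a b B ha ha1 hB hB3 hne
  set h : κ → ℝ := fun k => logHeight₁ (a k) with hhdef
  have ha0 : ∀ k, a k ≠ 0 := fun k => (ha k).ne'
  have ha2 : ∀ k, a k ≠ -1 := fun k h0 => by have := ha k; rw [h0] at this; norm_num at this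
  have hh2 : ∀ k, Real.log 2 ≤ h k := fun k => log_two_le_logHeight₁ (ha0 k) (ha1 k) (ha2 k)
  have hhpos : ∀ k, 0 < h k := fun k => lt_of_lt_of_le hl2 (hh2 k)
  have hB0 : 0 < B := by linarith
  have hlogB : 1 ≤ Real.log B := by
    rw [Real.le_log_iff_exp_le hB0]; have := Real.exp_one_lt_d9; linarith
  have hlog3h : ∀ k, 0 ≤ Real.log (3 * h k) := fun k =>
    Real.log_nonneg (by linarith [hh2 k, Real.log_two_gt_d9])
  set U := ∑ k, Real.log (3 * h k) with hU
  have hU0 : 0 ≤ U := Finset.sum_nonneg fun k _ => hlog3h k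
  have hb0 : b ≠ 0 := by intro h0; apply hne; simp [h0]
  have hn1 : 1 ≤ n := by
    by_contra h0; push Not at h0
    have : Fintype.card κ = 0 := by omega
    haveI : IsEmpty κ := Fintype.card_eq_zero_iff.mp this
    exact hb0 (funext fun k => isEmptyElim k)
  by_cases hindep : ∀ μ : κ → ℤ, ∏ k, a k ^ μ k = 1 → μ = 0
  · exact depArch_of_indepArch_base hC₀ hCC₀ hind a b B ha ha1 hB hB3 hne hindep
  push Not at hindep
  obtain ⟨μ, hμrel, hμ0⟩ := hindep
  obtain ⟨S, t, hSne, hsupp, htrel, hbd⟩ := exists_small_mult_relation ha0 hμ0 hμrel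
  obtain ⟨j, hjS⟩ := hSne
  set r : κ → ℤ := fun k => 2 * t k with hrdef
  have htj : t j ≠ 0 := (hsupp j).mpr hjS
  have hrj : r j ≠ 0 := mul_ne_zero two_ne_zero htj
  -- the size `ms` of the relation
  set c : κ → ℝ := fun l => 2 * logHeight₁ (a l) / Real.log 2 with hc
  set ms : ℝ := 2 * ∏ l ∈ S, c l with hms
  have hc2 : ∀ l, 2 ≤ c l := fun l => by
    rw [hc]; dsimp only; rw [le_div_iff₀ hl2]; linarith [hh2 l]
  have hc0 : ∀ l, 0 < c l := fun l => lt_of_lt_of_le two_pos (hc2 l)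
  have hP1 : 1 ≤ ∏ l ∈ S, c l := one_le_prod_of_one_le' S fun l => le_trans one_le_two (hc2 l)
  have hms2 : 2 ≤ ms := by rw [hms]; linarith
  have hms0 : 0 < ms := by linarith
  have habsr : ∀ k, |(r k : ℝ)| ≤ ms := by
    intro k
    rw [hrdef]; dsimp only; push_cast
    by_cases hk : k ∈ S
    · have h1 := hbd k hk
      have h2 : (∏ l ∈ S.erase k, c l) ≤ ∏ l ∈ S, c l := by
        rw [← Finset.mul_prod_erase S c hk]
        have h0 : 0 ≤ ∏ l ∈ S.erase k, c l := Finset.prod_nonneg fun l _ => (hc0 l).le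
        nlinarith [hc2 k]
      rw [abs_mul, abs_two, hms]
      linarith
    · have : t k = 0 := by by_contra h0; exact hk ((hsupp k).mp h0)
      rw [this]; simp; linarith
  have hlogms : Real.log ms ≤ 0.7 + 1.2 * S.card + ∑ l ∈ S, Real.log (logHeight₁ (a l)) :=
    Literature.Barriers.ABC.yu2007_mstar_log_aux hh2 hc hms
  -- new exponents
  set b' : κ → ℤ := fun k => r j * b k - r k * b j with hb'def
  have hB' : ∀ k : {k // k ≠ j}, |((b' k.val : ℤ) : ℝ)| ≤ 2 * ms * B := by
    intro k
    rw [hb'def]; dsimp only; push_cast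
    have h5 : |(r j : ℝ) * (b k.val : ℝ)| ≤ ms * B := by
      rw [abs_mul]; exact mul_le_mul (habsr j) (hB k.val) (abs_nonneg _) hms0.le
    have h6 : |(r k.val : ℝ) * (b j : ℝ)| ≤ ms * B := by
      rw [abs_mul]; exact mul_le_mul (habsr k.val) (hB j) (abs_nonneg _) hms0.le
    calc |(r j : ℝ) * (b k.val : ℝ) - (r k.val : ℝ) * (b j : ℝ)|
        ≤ |(r j : ℝ) * (b k.val : ℝ)| + |(r k.val : ℝ) * (b j : ℝ)| := abs_sub _ _
      _ ≤ 2 * ms * B := by linarith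
  have hB'3 : 3 ≤ 2 * ms * B := by nlinarith
  -- the transfer `(∏ a^b)^{r_j} = ∏_{k ≠ j} a^{b'}`
  have htrans : (∏ k, a k ^ b k) ^ r j = ∏ k ∈ univ.erase j, a k ^ b' k :=
    Literature.Barriers.ABC.prod_zpow_zpow_eq_prod_erase ha0 htrel b j
  have hP0 : (0 : ℚ) < ∏ k, a k ^ b k := Finset.prod_pos fun k _ => zpow_pos (ha k) _
  have hΞ'ne : ∏ k ∈ univ.erase j, a k ^ b' k ≠ 1 := by
    rw [← htrans]; intro h1
    rcases Literature.Barriers.ABC.rat_eq_sign_of_zpow_eq_one hrj h1 with h2 | h2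
    · exact hne h2
    · rw [h2] at hP0; norm_num at hP0
  -- the datum on `{k // k ≠ j}`
  obtain ⟨m, hm⟩ : ∃ m, n = m + 1 := ⟨n - 1, by omega⟩
  have hcard' : Fintype.card {k // k ≠ j} = m := by
    rw [Fintype.card_of_subtype (univ.erase j) (fun k => by simp), Finset.card_erase_of_mem
      (mem_univ j), card_univ, hcard, hm]; simp
  have hprod' : ∏ k : {k // k ≠ j}, a k.val ^ b' k.val = ∏ k ∈ univ.erase j, a k ^ b' k :=
    (Finset.prod_subtype (univ.erase j) (fun k => by simp) (fun k => a k ^ b' k)).symm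
  have hΛ' : ∏ k : {k // k ≠ j}, a k.val ^ b' k.val ≠ 1 := by rw [hprod']; exact hΞ'ne
  have hIH := IHn m (by omega) {k // k ≠ j} hcard' (fun k => a k.val) (fun k => b' k.val)
    (2 * ms * B) (fun k => ha k.val) (fun k => ha1 k.val) hB' hB'3 hΛ'
  rw [hcard'] at hIH
  have hHj' : ∏ k : {k // k ≠ j}, logHeight₁ (a k.val) = ∏ k ∈ univ.erase j, h k :=
    (Finset.prod_subtype (univ.erase j) (fun k => by simp) (fun k => h k)).symm
  have hUj' : ∑ k : {k // k ≠ j}, Real.log (3 * logHeight₁ (a k.val)) =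
      ∑ k ∈ univ.erase j, Real.log (3 * h k) :=
    (Finset.sum_subtype (univ.erase j) (fun k => by simp) (fun k => Real.log (3 * h k))).symm
  have hcastprod : ((∏ k : {k // k ≠ j}, a k.val ^ b' k.val : ℚ) : ℝ) =
      ((∏ k, a k ^ b k : ℚ) : ℝ) ^ r j := by
    rw [hprod', ← htrans]; push_cast; rfl
  rw [hHj', hUj', hcastprod, Real.log_zpow] at hIH
  -- `log|r_j · L| = log|r_j| + log|L|`
  set L := Real.log ((∏ k, a k ^ b k : ℚ) : ℝ) with hL
  have hL0 : L ≠ 0 := log_cast_prod_zpow_ne_zero a ha b hne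
  have hrj0 : ((r j : ℤ) : ℝ) ≠ 0 := by exact_mod_cast hrj
  have hsplit : Real.log |((r j : ℤ) : ℝ) * L| = Real.log |((r j : ℤ) : ℝ)| + Real.log |L| := by
    rw [abs_mul, Real.log_mul (abs_ne_zero.mpr hrj0) (abs_ne_zero.mpr hL0)]
  rw [hsplit] at hIH
  have hlogr : Real.log |((r j : ℤ) : ℝ)| ≤ Real.log ms :=
    Real.log_le_log (abs_pos.mpr hrj0) (habsr j)
  -- arithmetic of the step
  set Hj := ∏ k ∈ univ.erase j, h k with hHjdef
  set Uj := ∑ k ∈ univ.erase j, Real.log (3 * h k) with hUjdef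
  have hHj0 : 0 ≤ Hj := Finset.prod_nonneg fun k _ => (hhpos k).le
  have hUjU : Uj ≤ U := Finset.sum_le_sum_of_subset_of_nonneg (Finset.erase_subset j univ)
    fun k _ _ => hlog3h k
  have hSU : ∑ l ∈ S, Real.log (logHeight₁ (a l)) ≤ U := by
    have h1 : ∑ l ∈ S, Real.log (logHeight₁ (a l)) ≤ ∑ l ∈ S, Real.log (3 * h l) := by
      apply Finset.sum_le_sum; intro l _
      exact Real.log_le_log (hhpos l) (by linarith [hhpos l])
    exact h1.trans (Finset.sum_le_sum_of_subset_of_nonneg (Finset.subset_univ S)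
      fun k _ _ => hlog3h k)
  have hScard : (S.card : ℝ) ≤ n := by rw [← hcard]; exact_mod_cast Finset.card_le_univ S
  have hlogB' : Real.log (2 * ms * B) = Real.log 2 + Real.log ms + Real.log B := by
    rw [Real.log_mul (by positivity) hB0.ne', Real.log_mul two_ne_zero hms0.ne']
  have hmR : (m : ℝ) + 1 = n := by rw [hm]; push_cast; ring
  set slot := Real.log B + U + 2 * (n : ℝ) with hslotdef
  have hslot' : Real.log (2 * ms * B) + Uj + 2 * (m : ℝ) ≤ 2 * slot := by
    rw [hlogB', hslotdef]
    have := Real.log_two_lt_d9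
    nlinarith [hlogms, hSU, hUjU, hScard, hmR, hlogB, hU0]
  have hmsslot : Real.log ms ≤ slot := by
    rw [hslotdef]; nlinarith [hlogms, hSU, hScard, hlogB, hU0]
  have hslot0 : 0 ≤ slot := by rw [hslotdef]; positivity
  -- `log 2 ^ n ≤ ∏ h`, `C^m Hj ≥ 1`, `C h_j ≥ 3`
  have hprodsplit : ∏ k, h k = h j * Hj := (Finset.mul_prod_erase univ h (mem_univ j)).symm
  have hCmHj1 : 1 ≤ C ^ m * Hj := by
    have h1 : Real.log 2 ^ m ≤ Hj := by
      have hc' : (univ.erase j).card = m := by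
        rw [Finset.card_erase_of_mem (mem_univ j), card_univ, hcard, hm]; simp
      have : ∏ _i ∈ univ.erase j, Real.log 2 = Real.log 2 ^ m := by rw [Finset.prod_const, hc']
      rw [← this]
      exact Finset.prod_le_prod (fun i _ => hl2.le) fun i _ => hh2 i
    calc (1 : ℝ) ≤ (C * Real.log 2) ^ m := one_le_pow₀ (by linarith)
      _ = C ^ m * Real.log 2 ^ m := mul_pow _ _ _
      _ ≤ C ^ m * Hj := mul_le_mul_of_nonneg_left h1 (pow_nonneg hC0 m)
  have hCn : 2 * (C ^ m * Hj) + 1 ≤ C ^ n * ∏ k, h k := by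
    rw [hprodsplit, hm, pow_succ]
    have h1 : 3 ≤ C * h j := le_trans hC3 (mul_le_mul_of_nonneg_left (hh2 j) hC0)
    have h2 : 0 ≤ C ^ m * Hj := by linarith
    calc 2 * (C ^ m * Hj) + 1 ≤ 3 * (C ^ m * Hj) := by linarith
      _ ≤ (C * h j) * (C ^ m * Hj) := mul_le_mul_of_nonneg_right h1 h2
      _ = C ^ m * C * (h j * Hj) := by ring
  -- conclude
  rw [hcard]
  have e1 : C ^ m * Hj * (2 * slot) = 2 * (C ^ m * Hj * slot) := by ring
  have e2 : (2 * (C ^ m * Hj) + 1) * slot = 2 * (C ^ m * Hj * slot) + slot := by ring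
  have hIH' : -(2 * (C ^ m * Hj * slot)) ≤ Real.log |((r j : ℤ) : ℝ)| + Real.log |L| := by
    have h1 : C ^ m * Hj * (Real.log (2 * ms * B) + Uj + 2 * (m : ℝ)) ≤ C ^ m * Hj * (2 * slot) :=
      mul_le_mul_of_nonneg_left hslot' (by linarith)
    rw [e1] at h1
    linarith
  have hfin : 2 * (C ^ m * Hj * slot) + slot ≤ C ^ n * (∏ k, h k) * slot := by
    have h1 := mul_le_mul_of_nonneg_right hCn hslot0
    rw [e2] at h1
    exact h1
  show -(C ^ n * (∏ k, h k) * slot) ≤ Real.log |L|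
  linarith [hIH', hlogr, hmsslot, hfin]

end Literature.NumberTheory.DiophantineGeometry.Dioph

end
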